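import Mathlib

/-!
# T-S5.4y «covariance under a bounded density perturbation» — `|Cov_{(1+R)μ}(F,G) − Cov_μ(F,G)| ≤ 6·sup|R| · σ_F σ_G`

Abstract measure-theoretic brick for step (2) of the XL comparison stubs S5 (LINE-19 ⟨stmt-QuantumFields-24004⟩/⟨24335⟩ `stub_landauSecondOrder`)
and U5 (LINE-20 ⟨24336⟩).  It is the step that CONSUMES the precision of T-S5.4J (`OrbitNormaliserJacobian`: `|N_J/Z₀ − 1| ≤ e^{−cH⁴}`) and of
every other unstructured density factor in the Faddeev–Popov representation of the cold-box covariance `boxPlaqCov` (planner ym-idea-2 g18,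
bus 2026-08-29T18:11Z «PRECISION COUNT»: `Cov_ν' − Cov_ν ≲ R_*·σ_f σ_g`): reweighting a probability measure `μ` by a density `1 + R` with
`|R| ≤ δ ≤ ½` moves the covariance of two square-integrable observables by at most `6δ` standard deviations squared,

  `|Cov'(F,G) − Cov(F,G)| ≤ 6 δ σ_F σ_G`,  `Cov'(F,G) = ∫FG(1+R)/m − (∫F(1+R)/m)(∫G(1+R)/m)`, `m = ∫(1+R)`, `σ_F² = ∫(F − ∫F)²`

(`abs_cov_density_sub_cov_le`).  The point for S5: `σ_F σ_G ≍ β⁻²` for plaquette costs while the signal is `β⁻²T⁻⁸`, so an unstructured factor is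
admissible iff `δ ≪ T⁻⁸` — which is why T-S5.4 had to be re-typed in Jacobian form.  Also: the Cauchy–Schwarz forms used
(`abs_integral_mul_le_sqrt_mul_sqrt`, `integral_abs_le_sqrt_integral_sq`) and the exact perturbation identity (`cov_density_sub_cov_eq`).

Mathlib only; no definitions.  HONEST LABEL: an elementary brick of step (2); T-S5.4J, S5, U5, ⟨24004⟩ ⟨24335⟩ ⟨24336⟩ remain OPEN; no summit is
proved; the Yang–Mills mass gap is NOT proved by this file.  Seat ym-line-sfw-p2 g77 (LEAD, cell ym-idea-1).
-/

set_option autoImplicit false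

noncomputable section

open MeasureTheory

namespace Summit.QuantumFields.YangMills.Theorems.AllWindowsColdBoxBoxHighLine

namespace CovariancePerturbation

variable {Ω : Type*} [MeasurableSpace Ω] {μ : Measure Ω}

/-- Cauchy–Schwarz: `|∫ f g| ≤ √(∫ f²) · √(∫ g²)` for `f, g ∈ L²(μ)`. -/
theorem abs_integral_mul_le_sqrt_mul_sqrt {f g : Ω → ℝ} (hf : MemLp f 2 μ) (hg : MemLp g 2 μ) :
    |∫ x, f x * g x ∂μ| ≤ Real.sqrt (∫ x, f x ^ 2 ∂μ) * Real.sqrt (∫ x, g x ^ 2 ∂μ) := by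
  have h2 : ENNReal.ofReal (2 : ℝ) = 2 := by norm_num
  have hfa : MemLp (fun x => |f x|) (ENNReal.ofReal 2) μ := h2 ▸ hf.abs
  have hga : MemLp (fun x => |g x|) (ENNReal.ofReal 2) μ := h2 ▸ hg.abs
  have key := integral_mul_le_Lp_mul_Lq_of_nonneg Real.HolderConjugate.two_two
    (ae_of_all _ fun x => abs_nonneg (f x)) (ae_of_all _ fun x => abs_nonneg (g x)) hfa hga
  simp only [Real.rpow_two, sq_abs] at key
  rw [Real.sqrt_eq_rpow, Real.sqrt_eq_rpow]
  refine le_trans ?_ key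
  calc |∫ x, f x * g x ∂μ| ≤ ∫ x, |f x * g x| ∂μ := abs_integral_le_integral_abs
    _ = ∫ x, |f x| * |g x| ∂μ := integral_congr_ae (ae_of_all _ fun x => abs_mul _ _)

/-- On a probability space, `∫ |f| ≤ √(∫ f²)`. -/
theorem integral_abs_le_sqrt_integral_sq [IsProbabilityMeasure μ] {f : Ω → ℝ} (hf : MemLp f 2 μ) :
    ∫ x, |f x| ∂μ ≤ Real.sqrt (∫ x, f x ^ 2 ∂μ) := by
  have hfa : MemLp (fun x => |f x|) 2 μ := hf.abs
  have h := abs_integral_mul_le_sqrt_mul_sqrt hfa (memLp_const (1 : ℝ))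
  simp only [mul_one, one_pow, integral_const, probReal_univ, smul_eq_mul, Real.sqrt_one, sq_abs] at h
  rwa [abs_of_nonneg (integral_nonneg fun x => abs_nonneg _)] at h

/-- A bounded weight: `|∫ f R| ≤ δ ∫|f|` for `|R| ≤ δ`. -/
theorem abs_integral_mul_bdd_le {f R : Ω → ℝ} {δ : ℝ} (hR : ∀ x, |R x| ≤ δ) (hf : Integrable f μ) :
    |∫ x, f x * R x ∂μ| ≤ δ * ∫ x, |f x| ∂μ := by
  calc |∫ x, f x * R x ∂μ| ≤ ∫ x, |f x * R x| ∂μ := abs_integral_le_integral_abs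
    _ ≤ ∫ x, δ * |f x| ∂μ := by
        refine integral_mono_of_nonneg (ae_of_all _ fun x => abs_nonneg _) (hf.abs.const_mul δ) (ae_of_all _ fun x => ?_)
        show |f x * R x| ≤ δ * |f x|
        rw [abs_mul, mul_comm]
        exact mul_le_mul_of_nonneg_right (hR x) (abs_nonneg _)
    _ = δ * ∫ x, |f x| ∂μ := integral_const_mul _ _

/-- **The exact perturbation identity** (pure algebra): with `m = 1 + r`, `a = a' − A r`, `b = b' − B r`, `c = P − A B`,
`d = d' − A b' − B a' + A B r` (the centred first and second moments against `R`),
`(P + d')/m − (A + a')(B + b')/m² − (P − A B) = c·(1/m − 1) + d/m − a·b/m²`. -/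
theorem cov_density_sub_cov_eq (A B P a' b' d' r : ℝ) (hm : 1 + r ≠ 0) :
    (P + d') / (1 + r) - (A + a') / (1 + r) * ((B + b') / (1 + r)) - (P - A * B) =
      (P - A * B) * (1 / (1 + r) - 1) + (d' - A * b' - B * a' + A * B * r) / (1 + r) -
        (a' - A * r) * (b' - B * r) / (1 + r) ^ 2 := by
  have hu : (1 + r) * (1 + r)⁻¹ = 1 := mul_inv_cancel₀ hm
  simp only [div_eq_mul_inv, ← inv_pow, one_mul]
  linear_combination (A * B * (r - 1) * (1 + r)⁻¹ - (A * b' + B * a') * (1 + r)⁻¹) * hu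

end CovariancePerturbation

open CovariancePerturbation

/-- **Covariance under a bounded density perturbation.**  Let `μ` be a probability measure, `F, G ∈ L²(μ)`, and `R` a measurable weight
with `|R| ≤ δ`, `0 ≤ δ ≤ ½`; put `m = ∫(1+R) dμ` and `σ_F = √(∫(F − ∫F)²)`, `σ_G` likewise.  Then the covariance under the reweighted
probability `(1+R)μ/m` differs from the covariance under `μ` by at most `6δ σ_F σ_G`:
`|∫FG(1+R)/m − (∫F(1+R)/m)(∫G(1+R)/m) − (∫FG − ∫F∫G)| ≤ 6 δ σ_F σ_G`. -/
theorem abs_cov_density_sub_cov_le {Ω : Type*} [MeasurableSpace Ω] (μ : Measure Ω) [IsProbabilityMeasure μ]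
    {F G R : Ω → ℝ} {δ : ℝ} (hF : MemLp F 2 μ) (hG : MemLp G 2 μ) (hRm : AEStronglyMeasurable R μ)
    (hR : ∀ x, |R x| ≤ δ) (hδ0 : 0 ≤ δ) (hδ : δ ≤ 1 / 2) :
    |(∫ x, F x * G x * (1 + R x) ∂μ) / (∫ x, (1 + R x) ∂μ) -
        (∫ x, F x * (1 + R x) ∂μ) / (∫ x, (1 + R x) ∂μ) * ((∫ x, G x * (1 + R x) ∂μ) / (∫ x, (1 + R x) ∂μ)) -
        ((∫ x, F x * G x ∂μ) - (∫ x, F x ∂μ) * (∫ x, G x ∂μ))| ≤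
      6 * δ * Real.sqrt (∫ x, (F x - ∫ y, F y ∂μ) ^ 2 ∂μ) * Real.sqrt (∫ x, (G x - ∫ y, G y ∂μ) ^ 2 ∂μ) := by
  -- integrability bookkeeping
  have hF1 : Integrable F μ := hF.integrable one_le_two
  have hG1 : Integrable G μ := hG.integrable one_le_two
  have hFG : Integrable (fun x => F x * G x) μ := hF.integrable_mul hG
  have hRbd : ∀ᵐ x ∂μ, ‖R x‖ ≤ δ := ae_of_all _ fun x => by rw [Real.norm_eq_abs]; exact hR x
  have hR1 : Integrable R μ := by
    have h := (integrable_const (1 : ℝ)).bdd_mul hRm hRbd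
    simpa using h
  have hFR : Integrable (fun x => F x * R x) μ := by
    have h := hF1.bdd_mul hRm hRbd
    simpa only [mul_comm] using h
  have hGR : Integrable (fun x => G x * R x) μ := by
    have h := hG1.bdd_mul hRm hRbd
    simpa only [mul_comm] using h
  have hFGR : Integrable (fun x => F x * G x * R x) μ := by
    have h := hFG.bdd_mul hRm hRbd
    simpa only [mul_comm] using h
  -- names for the raw moments
  obtain ⟨A, hA⟩ : ∃ A : ℝ, ∫ x, F x ∂μ = A := ⟨_, rfl⟩
  obtain ⟨B, hB⟩ : ∃ B : ℝ, ∫ x, G x ∂μ = B := ⟨_, rfl⟩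
  obtain ⟨P, hP⟩ : ∃ P : ℝ, ∫ x, F x * G x ∂μ = P := ⟨_, rfl⟩
  obtain ⟨a', ha'⟩ : ∃ a' : ℝ, ∫ x, F x * R x ∂μ = a' := ⟨_, rfl⟩
  obtain ⟨b', hb'⟩ : ∃ b' : ℝ, ∫ x, G x * R x ∂μ = b' := ⟨_, rfl⟩
  obtain ⟨d', hd'⟩ : ∃ d' : ℝ, ∫ x, F x * G x * R x ∂μ = d' := ⟨_, rfl⟩
  obtain ⟨r, hr⟩ : ∃ r : ℝ, ∫ x, R x ∂μ = r := ⟨_, rfl⟩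
  -- the weighted integrals in terms of the raw moments
  have hm : ∫ x, (1 + R x) ∂μ = 1 + r := by
    rw [integral_add (integrable_const _) hR1, integral_const, probReal_univ, one_smul, hr]
  have hFw : ∫ x, F x * (1 + R x) ∂μ = A + a' := by
    have : (fun x => F x * (1 + R x)) = fun x => F x + F x * R x := by funext x; ring
    rw [this, integral_add hF1 hFR, hA, ha']
  have hGw : ∫ x, G x * (1 + R x) ∂μ = B + b' := by
    have : (fun x => G x * (1 + R x)) = fun x => G x + G x * R x := by funext x; ring
    rw [this, integral_add hG1 hGR, hB, hb']
  have hFGw : ∫ x, F x * G x * (1 + R x) ∂μ = P + d' := by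
    have : (fun x => F x * G x * (1 + R x)) = fun x => F x * G x + F x * G x * R x := by funext x; ring
    rw [this, integral_add hFG hFGR, hP, hd']
  -- |r| ≤ δ, so m ≥ 1/2
  have hrδ : |r| ≤ δ := by
    have h := abs_integral_mul_bdd_le (μ := μ) hR (integrable_const (1 : ℝ))
    simp only [one_mul, abs_one, integral_const, probReal_univ, smul_eq_mul, mul_one] at h
    rwa [hr] at h
  have hm0 : 1 / 2 ≤ 1 + r := by have := neg_abs_le r; linarith
  have hmpos : 0 < 1 + r := by linarith
  have hmne : 1 + r ≠ 0 := hmpos.ne'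
  -- the centred functions
  have hf2 : MemLp (fun x => F x - A) 2 μ := hF.sub (memLp_const A)
  have hg2 : MemLp (fun x => G x - B) 2 μ := hG.sub (memLp_const B)
  have hf1 : Integrable (fun x => F x - A) μ := hf2.integrable one_le_two
  have hg1 : Integrable (fun x => G x - B) μ := hg2.integrable one_le_two
  have hfg : Integrable (fun x => (F x - A) * (G x - B)) μ := hf2.integrable_mul hg2
  -- centred moments against R in terms of the raw ones
  have ha : ∫ x, (F x - A) * R x ∂μ = a' - A * r := by
    have : (fun x => (F x - A) * R x) = fun x => F x * R x - A * R x := by funext x; ring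
    have i1 : Integrable (fun x => A * R x) μ := hR1.const_mul A
    rw [this, integral_sub hFR i1, integral_const_mul, ha', hr]
  have hb : ∫ x, (G x - B) * R x ∂μ = b' - B * r := by
    have : (fun x => (G x - B) * R x) = fun x => G x * R x - B * R x := by funext x; ring
    have i1 : Integrable (fun x => B * R x) μ := hR1.const_mul B
    rw [this, integral_sub hGR i1, integral_const_mul, hb', hr]
  have hc : ∫ x, (F x - A) * (G x - B) ∂μ = P - A * B := by
    have : (fun x => (F x - A) * (G x - B)) = fun x => F x * G x - A * G x - B * F x + A * B := by funext x; ring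
    have i1 : Integrable (fun x => A * G x) μ := hG1.const_mul A
    have i2 : Integrable (fun x => B * F x) μ := hF1.const_mul B
    have i3 : Integrable (fun x => F x * G x - A * G x) μ := hFG.sub i1
    have i4 : Integrable (fun x => F x * G x - A * G x - B * F x) μ := i3.sub i2
    rw [this, integral_add i4 (integrable_const _), integral_sub i3 i2, integral_sub hFG i1,
      integral_const_mul, integral_const_mul, integral_const, probReal_univ, one_smul, hP, hA, hB]
    ring
  have hd : ∫ x, (F x - A) * (G x - B) * R x ∂μ = d' - A * b' - B * a' + A * B * r := by
    have : (fun x => (F x - A) * (G x - B) * R x) =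
        fun x => F x * G x * R x - A * (G x * R x) - B * (F x * R x) + A * B * R x := by
      funext x; ring
    have i1 : Integrable (fun x => A * (G x * R x)) μ := hGR.const_mul A
    have i2 : Integrable (fun x => B * (F x * R x)) μ := hFR.const_mul B
    have i3 : Integrable (fun x => F x * G x * R x - A * (G x * R x)) μ := hFGR.sub i1
    have i4 : Integrable (fun x => F x * G x * R x - A * (G x * R x) - B * (F x * R x)) μ := i3.sub i2
    have i5 : Integrable (fun x => A * B * R x) μ := hR1.const_mul _
    rw [this, integral_add i4 i5, integral_sub i3 i2, integral_sub hFGR i1,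
      integral_const_mul, integral_const_mul, integral_const_mul, hd', ha', hb', hr]
  -- shorthand for the standard deviations
  obtain ⟨sf, hsf⟩ : ∃ sf : ℝ, Real.sqrt (∫ x, (F x - A) ^ 2 ∂μ) = sf := ⟨_, rfl⟩
  obtain ⟨sg, hsg⟩ : ∃ sg : ℝ, Real.sqrt (∫ x, (G x - B) ^ 2 ∂μ) = sg := ⟨_, rfl⟩
  have hsf0 : 0 ≤ sf := by rw [← hsf]; exact Real.sqrt_nonneg _
  have hsg0 : 0 ≤ sg := by rw [← hsg]; exact Real.sqrt_nonneg _
  -- the bounds on the centred moments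
  have hcb : |P - A * B| ≤ sf * sg := by
    rw [← hc, ← hsf, ← hsg]; exact abs_integral_mul_le_sqrt_mul_sqrt hf2 hg2
  have hab : |a' - A * r| ≤ δ * sf := by
    rw [← ha, ← hsf]
    exact (abs_integral_mul_bdd_le hR hf1).trans (mul_le_mul_of_nonneg_left (integral_abs_le_sqrt_integral_sq hf2) hδ0)
  have hbb : |b' - B * r| ≤ δ * sg := by
    rw [← hb, ← hsg]
    exact (abs_integral_mul_bdd_le hR hg1).trans (mul_le_mul_of_nonneg_left (integral_abs_le_sqrt_integral_sq hg2) hδ0)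
  have hdb : |d' - A * b' - B * a' + A * B * r| ≤ δ * (sf * sg) := by
    rw [← hd, ← hsf, ← hsg]
    refine (abs_integral_mul_bdd_le hR hfg).trans (mul_le_mul_of_nonneg_left ?_ hδ0)
    have hfa : MemLp (fun x => |F x - A|) 2 μ := hf2.abs
    have hga : MemLp (fun x => |G x - B|) 2 μ := hg2.abs
    have h := abs_integral_mul_le_sqrt_mul_sqrt hfa hga
    simp only [sq_abs] at h
    have habs : ∫ x, |(F x - A) * (G x - B)| ∂μ = ∫ x, |F x - A| * |G x - B| ∂μ :=
      integral_congr_ae (ae_of_all _ fun x => abs_mul _ _)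
    rw [habs]
    rwa [abs_of_nonneg (integral_nonneg fun x => mul_nonneg (abs_nonneg _) (abs_nonneg _))] at h
  -- assemble
  rw [hm, hFw, hGw, hFGw, hP, hA, hB, hsf, hsg, cov_density_sub_cov_eq A B P a' b' d' r hmne]
  have hinv : 1 / (1 + r) ≤ 2 := by rw [div_le_iff₀ hmpos]; linarith
  have hinv0 : 0 ≤ 1 / (1 + r) := by positivity
  have h1 : |(P - A * B) * (1 / (1 + r) - 1)| ≤ sf * sg * (2 * δ) := by
    rw [abs_mul]
    refine mul_le_mul hcb ?_ (abs_nonneg _) (mul_nonneg hsf0 hsg0)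
    rw [show 1 / (1 + r) - 1 = -r * (1 / (1 + r)) by field_simp; ring, abs_mul, abs_neg, abs_of_nonneg hinv0]
    calc |r| * (1 / (1 + r)) ≤ δ * 2 := mul_le_mul hrδ hinv hinv0 hδ0
      _ = 2 * δ := by ring
  have h2 : |(d' - A * b' - B * a' + A * B * r) / (1 + r)| ≤ δ * (sf * sg) * 2 := by
    rw [abs_div, abs_of_pos hmpos, div_eq_mul_one_div]
    exact mul_le_mul hdb hinv hinv0 (by positivity)
  have h3 : |(a' - A * r) * (b' - B * r) / (1 + r) ^ 2| ≤ δ * sf * (δ * sg) * 4 := by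
    rw [abs_div, abs_mul, abs_of_pos (by positivity : (0 : ℝ) < (1 + r) ^ 2), div_eq_mul_one_div]
    have h4 : 1 / (1 + r) ^ 2 ≤ 4 := by
      rw [div_le_iff₀ (by positivity)]; nlinarith
    exact mul_le_mul (mul_le_mul hab hbb (abs_nonneg _) (by positivity)) h4 (by positivity) (by positivity)
  have hss : 0 ≤ sf * sg := mul_nonneg hsf0 hsg0
  have hδ2 : δ * δ * (sf * sg) ≤ δ / 2 * (sf * sg) := mul_le_mul_of_nonneg_right (by nlinarith) hss
  calc |(P - A * B) * (1 / (1 + r) - 1) + (d' - A * b' - B * a' + A * B * r) / (1 + r) -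
          (a' - A * r) * (b' - B * r) / (1 + r) ^ 2|
      ≤ |(P - A * B) * (1 / (1 + r) - 1)| + |(d' - A * b' - B * a' + A * B * r) / (1 + r)| +
          |(a' - A * r) * (b' - B * r) / (1 + r) ^ 2| := by
        refine (abs_sub _ _).trans ?_
        have := abs_add_le ((P - A * B) * (1 / (1 + r) - 1)) ((d' - A * b' - B * a' + A * B * r) / (1 + r))
        linarith
    _ ≤ sf * sg * (2 * δ) + δ * (sf * sg) * 2 + δ * sf * (δ * sg) * 4 := by linarith
    _ = 4 * δ * (sf * sg) + 4 * (δ * δ * (sf * sg)) := by ring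
    _ ≤ 4 * δ * (sf * sg) + 4 * (δ / 2 * (sf * sg)) := by linarith
    _ = 6 * δ * sf * sg := by ring

end Summit.QuantumFields.YangMills.Theorems.AllWindowsColdBoxBoxHighLine

end
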